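import Literature.NumberTheory.Transcendental.NonCMRationalSubspaces
import Literature.NumberTheory.Transcendental.TwoCurvePeriods
import Mathlib.LinearAlgebra.Basis.VectorSpace
import HarnessLib

/-!
# Complex subspaces spanned by lattice vectors of two non-isogenous lattices are products of rational subspaces

Topic `Literature/NumberTheory/Transcendental`; unit
`provefact-Literature.NumberTheory.Transcendental.H-a66b67e3eb` (fact
`Literature.NumberTheory.Transcendental.HuberWustholzTwoCurvePeriods`). It introduces NO named fact.
The two-lattice (non-isogenous) companion of `NonCMRationalSubspaces.lean`: the arithmetic kernel
of the classification of the connected algebraic subgroups of `E^γ × E'^{γ'}` for two elliptic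
curves `E = ℂ/Λ`, `E' = ℂ/Λ'` WITHOUT complex multiplication and NOT isogenous
(`End E = End E' = ℤ`, `Hom(E, E') = 0`), in the analytic form needed by the two-lattice theta
programme (`TwoCurveThetaOrbits.philippon_of_hull`).

* `NonIsogLattice.inlV_fstV_mem` (`inlV_mem_of_lattice`) — if a complex subspace `W ≤ ℂ^{γ ⊕ γ'}` is contained in the
  REAL span of its lattice vectors (`m ∈ W` with `m_b ∈ Λ` for `b ∈ γ` and `m_b ∈ Λ'` for
  `b ∈ γ'`), then `W` is a PRODUCT: with every `w ∈ W` it contains its `γ`-part `(w_γ, 0)`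
  (and its `γ'`-part). Proof: if `(m_γ, 0) ∉ W` for a lattice vector `m`, a rational relation `c'`
  of the `γ'`-slice `W ∩ ℂ^{γ'}` (rational by the one-lattice theorem for `Λ'`) gives a
  `ℂ`-linear functional `Φ(w) = ∑ c'_b w_b` on `W` that only depends on the `γ`-part of `w`,
  takes values in `ℚ Λ'` on the vectors with rational coordinates, and satisfies
  `Φ(lift of p ω₂) = τ Φ(lift of p ω₁)` (`τ = ω₂/ω₁`); a non-zero `x ∈ ℚΛ'` with `τ x ∈ ℚΛ'`
  makes `Λ` and `Λ'` isogenous (`isIsogenousTo_of_tau_mul_mem`);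
* `NonIsogLattice.exists_ratRels` — hence `W = {z ; ∑_b c_b z_b = 0 (c ∈ C), ∑_b c'_b z'_b = 0 (c' ∈ C')}`
  for `ℚ`-subspaces `C ≤ ℚ^γ`, `C' ≤ ℚ^{γ'}` — the shape `(C, C')` of `GaGmEE.Std.SubgroupDataC`.

Tools: the blockwise rational projections `ratProj₂ χ` attached to `ℚ`-linear `χ : ℝ → ℚ`
(`NonCMLattice.ratProj` on each block), which map the real span of the lattice vectors of `W`
into `W`, fix rational vectors when `χ 1 = 1` (`exists_ratRetraction`), and reconstruct every
vector from a Hamel basis of `ℝ` over `ℚ` (`eq_sum_ratProj₂`). Everything is PROVED.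

## References

* D. Bertrand, P. Philippon, *Sous-groupes algébriques de groupes algébriques commutatifs*,
  Illinois J. Math. 32 (1988), 263–280, §1. [folklore]
* D. W. Masser, *Elliptic Functions and Transcendence*, LNM 437, Springer 1975, Ch. II. [Masser1975]
* A. Huber, G. Wüstholz, *Transcendence and Linear Relations of 1-Periods*, CUP 2022, Thm. 15.3
  (isotypic decomposition: `Hom(E, E') = 0`). [HuberWustholz2022]
-/

noncomputable section

open Complex Module

namespace Literature.NumberTheory.Transcendental

namespace NonIsogLattice

open NonCMLattice

variable (L L' : PeriodPair)

/-! ### The isogeny criterion -/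

/-- **A non-zero `x ∈ ℚ ω₁' + ℚ ω₂'` with `τ x ∈ ℚ ω₁' + ℚ ω₂'` (`τ = ω₂/ω₁` of `Λ`) makes `Λ`
and `Λ'` isogenous**: `α = d x / ω₁` (for a common denominator `d`) maps `Λ` into `Λ'`. [folklore] -/
theorem isIsogenousTo_of_tau_mul_mem (a b a' b' : ℚ)
    (hx : (a : ℂ) * L'.ω₁ + (b : ℂ) * L'.ω₂ ≠ 0)
    (hτ : tau L * ((a : ℂ) * L'.ω₁ + (b : ℂ) * L'.ω₂) = (a' : ℂ) * L'.ω₁ + (b' : ℂ) * L'.ω₂) :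
    L.IsIsogenousTo L' := by
  set x : ℂ := (a : ℂ) * L'.ω₁ + (b : ℂ) * L'.ω₂ with hxdef
  -- a common denominator
  set d : ℕ := a.den * b.den * a'.den * b'.den with hd
  have hdpos : 0 < d := by
    rw [hd]
    exact Nat.mul_pos (Nat.mul_pos (Nat.mul_pos a.den_pos b.den_pos) a'.den_pos) b'.den_pos
  -- `d q` is an integer for `q ∈ {a, b, a', b'}`
  have hint : ∀ q : ℚ, q.den ∣ d → ∃ z : ℤ, ((d : ℚ) * q) = z := by
    intro q hq
    obtain ⟨k, hk⟩ := hq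
    refine ⟨k * q.num, ?_⟩
    have h := Rat.mul_den_eq_num q
    rw [hk]
    push_cast
    linear_combination (k : ℚ) * h
  obtain ⟨za, hza⟩ := hint a ⟨b.den * a'.den * b'.den, by rw [hd]; ring⟩
  obtain ⟨zb, hzb⟩ := hint b ⟨a.den * a'.den * b'.den, by rw [hd]; ring⟩
  obtain ⟨za', hza'⟩ := hint a' ⟨a.den * b.den * b'.den, by rw [hd]; ring⟩
  obtain ⟨zb', hzb'⟩ := hint b' ⟨a.den * b.den * a'.den, by rw [hd]; ring⟩
  have cast_eq : ∀ (q : ℚ) (z : ℤ), ((d : ℚ) * q) = z → (d : ℂ) * (q : ℂ) = (z : ℂ) := by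
    intro q z h
    exact_mod_cast congrArg (fun t : ℚ => (t : ℂ)) h
  have ea := cast_eq a za hza
  have eb := cast_eq b zb hzb
  have ea' := cast_eq a' za' hza'
  have eb' := cast_eq b' zb' hzb'
  -- `d x ∈ Λ'` and `d τ x ∈ Λ'`
  have hdx : (d : ℂ) * x = (za : ℂ) * L'.ω₁ + (zb : ℂ) * L'.ω₂ := by
    rw [hxdef]; linear_combination L'.ω₁ * ea + L'.ω₂ * eb
  have hdτx : (d : ℂ) * (tau L * x) = (za' : ℂ) * L'.ω₁ + (zb' : ℂ) * L'.ω₂ := by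
    rw [hτ]; linear_combination L'.ω₁ * ea' + L'.ω₂ * eb'
  refine ⟨(d : ℂ) * x / L.ω₁, ?_, fun l hl => ?_⟩
  · exact div_ne_zero (mul_ne_zero (by exact_mod_cast hdpos.ne') hx) (ω₁_ne_zero L)
  · obtain ⟨m, n, rfl⟩ := PeriodPair.mem_lattice.mp hl
    have e : (d : ℂ) * x / L.ω₁ * (m * L.ω₁ + n * L.ω₂) = (m : ℂ) * ((d : ℂ) * x) + (n : ℂ) * ((d : ℂ) * (tau L * x)) := by
      rw [← tau_mul_ω₁ L]
      field_simp [ω₁_ne_zero L]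
    rw [e, hdx, hdτx]
    have : (m : ℂ) * ((za : ℂ) * L'.ω₁ + (zb : ℂ) * L'.ω₂) + (n : ℂ) * ((za' : ℂ) * L'.ω₁ + (zb' : ℂ) * L'.ω₂) =
        ((m * za + n * za' : ℤ) : ℂ) * L'.ω₁ + ((m * zb + n * zb' : ℤ) : ℂ) * L'.ω₂ := by
      push_cast; ring
    rw [this]
    exact PeriodPair.mem_lattice.mpr ⟨_, _, rfl⟩

/-! ### A rational retraction of `ℝ` -/

/-- **A `ℚ`-linear functional on `ℝ` with `χ 1 = 1`** (coordinate of a Hamel basis through `1`).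
[folklore] -/
theorem exists_ratRetraction : ∃ χ : ℝ →ₗ[ℚ] ℚ, χ 1 = 1 := by
  have hli : LinearIndepOn ℚ id ({(1 : ℝ)} : Set ℝ) := LinearIndepOn.singleton (v := id) one_ne_zero
  set bR := Module.Basis.extend hli with hbR
  have h1 : (1 : ℝ) ∈ hli.extend (Set.subset_univ _) := Module.Basis.subset_extend hli rfl
  refine ⟨bR.coord ⟨1, h1⟩, ?_⟩
  have hb : bR ⟨1, h1⟩ = 1 := Module.Basis.extend_apply_self hli ⟨1, h1⟩
  have : bR.coord ⟨1, h1⟩ (bR ⟨1, h1⟩) = 1 := by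
    simp [Module.Basis.coord_apply, Module.Basis.repr_self]
  rwa [hb] at this

/-! ### Blockwise rational projections -/

variable {γ γ' : Type*}

/-- The blockwise rational projection: `NonCMLattice.ratProj L χ` on the `γ`-block,
`NonCMLattice.ratProj L' χ` on the `γ'`-block. [folklore] -/
def ratProj₂ (χ : ℝ →ₗ[ℚ] ℚ) : (γ ⊕ γ' → ℂ) →+ (γ ⊕ γ' → ℂ) where
  toFun z := Sum.elim (ratProj L χ (z ∘ Sum.inl)) (ratProj L' χ (z ∘ Sum.inr))
  map_zero' := by
    ext b
    rcases b with b | b <;> simp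
  map_add' z w := by
    ext b
    rcases b with b | b
    · simp only [Sum.elim_inl, Pi.add_apply]
      rw [show (z + w) ∘ Sum.inl = z ∘ Sum.inl + w ∘ Sum.inl from rfl, map_add, Pi.add_apply]
    · simp only [Sum.elim_inr, Pi.add_apply]
      rw [show (z + w) ∘ Sum.inr = z ∘ Sum.inr + w ∘ Sum.inr from rfl, map_add, Pi.add_apply]

/-- The `γ`-entries. [folklore] -/
theorem ratProj₂_inl (χ : ℝ →ₗ[ℚ] ℚ) (z : γ ⊕ γ' → ℂ) (b : γ) :
    ratProj₂ L L' χ z (Sum.inl b) =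
      (χ (reCoord L 0 (z (Sum.inl b))) : ℂ) * L.ω₁ + (χ (reCoord L 1 (z (Sum.inl b))) : ℂ) * L.ω₂ := rfl

/-- The `γ'`-entries. [folklore] -/
theorem ratProj₂_inr (χ : ℝ →ₗ[ℚ] ℚ) (z : γ ⊕ γ' → ℂ) (b : γ') :
    ratProj₂ L L' χ z (Sum.inr b) =
      (χ (reCoord L' 0 (z (Sum.inr b))) : ℂ) * L'.ω₁ + (χ (reCoord L' 1 (z (Sum.inr b))) : ℂ) * L'.ω₂ := rfl

/-- A vector with **rational coordinates** blockwise: `m_b = p_b ω₁ + q_b ω₂` (`b ∈ γ`),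
`m_b = p'_b ω₁' + q'_b ω₂'` (`b ∈ γ'`) with rational `p, q, p', q'`. [folklore] -/
def IsRatVec (m : γ ⊕ γ' → ℂ) : Prop :=
  (∀ b, ∃ p q : ℚ, m (Sum.inl b) = (p : ℂ) * L.ω₁ + (q : ℂ) * L.ω₂) ∧
    ∀ b, ∃ p q : ℚ, m (Sum.inr b) = (p : ℂ) * L'.ω₁ + (q : ℂ) * L'.ω₂

/-- Lattice vectors have rational coordinates. [folklore] -/
theorem isRatVec_of_lattice {m : γ ⊕ γ' → ℂ} (hl : ∀ b, m (Sum.inl b) ∈ L.lattice)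
    (hl' : ∀ b, m (Sum.inr b) ∈ L'.lattice) : IsRatVec L L' m := by
  refine ⟨fun b => ?_, fun b => ?_⟩
  · obtain ⟨p, q, h⟩ := PeriodPair.mem_lattice.mp (hl b)
    exact ⟨p, q, by rw [← h]; push_cast; ring⟩
  · obtain ⟨p, q, h⟩ := PeriodPair.mem_lattice.mp (hl' b)
    exact ⟨p, q, by rw [← h]; push_cast; ring⟩

/-- Images of the rational projection have rational coordinates. [folklore] -/
theorem isRatVec_ratProj₂ (χ : ℝ →ₗ[ℚ] ℚ) (z : γ ⊕ γ' → ℂ) : IsRatVec L L' (ratProj₂ L L' χ z) :=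
  ⟨fun b => ⟨_, _, ratProj₂_inl L L' χ z b⟩, fun b => ⟨_, _, ratProj₂_inr L L' χ z b⟩⟩

/-- **On a real multiple of a rational vector the projection is `χ(r) · m`.** [folklore] -/
theorem ratProj₂_smul_ratVec (χ : ℝ →ₗ[ℚ] ℚ) (r : ℝ) {m : γ ⊕ γ' → ℂ} (hm : IsRatVec L L' m) :
    ratProj₂ L L' χ (r • m) = (χ r : ℂ) • m := by
  ext b
  rcases b with b | b
  · obtain ⟨p, q, hpq⟩ := hm.1 b
    rw [ratProj₂_inl, Pi.smul_apply, Pi.smul_apply, hpq, Complex.real_smul, smul_eq_mul]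
    have e : (r : ℂ) * ((p : ℂ) * L.ω₁ + (q : ℂ) * L.ω₂) =
        ((p • r : ℝ) : ℂ) * L.ω₁ + ((q • r : ℝ) : ℂ) * L.ω₂ := by
      rw [Rat.smul_def, Rat.smul_def]; push_cast; ring
    rw [e, (reCoord_combo L _ _).1, (reCoord_combo L _ _).2, map_smul, map_smul, smul_eq_mul, smul_eq_mul]
    push_cast
    ring
  · obtain ⟨p, q, hpq⟩ := hm.2 b
    rw [ratProj₂_inr, Pi.smul_apply, Pi.smul_apply, hpq, Complex.real_smul, smul_eq_mul]
    have e : (r : ℂ) * ((p : ℂ) * L'.ω₁ + (q : ℂ) * L'.ω₂) =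
        ((p • r : ℝ) : ℂ) * L'.ω₁ + ((q • r : ℝ) : ℂ) * L'.ω₂ := by
      rw [Rat.smul_def, Rat.smul_def]; push_cast; ring
    rw [e, (reCoord_combo L' _ _).1, (reCoord_combo L' _ _).2, map_smul, map_smul, smul_eq_mul, smul_eq_mul]
    push_cast
    ring

/-- A retraction fixes rational vectors. [folklore] -/
theorem ratProj₂_ratVec {χ : ℝ →ₗ[ℚ] ℚ} (hχ : χ 1 = 1) {m : γ ⊕ γ' → ℂ} (hm : IsRatVec L L' m) :
    ratProj₂ L L' χ m = m := by
  have := ratProj₂_smul_ratVec L L' χ 1 hm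
  rwa [one_smul, hχ, Rat.cast_one, one_smul] at this

/-- The lattice vectors of `W`. [folklore] -/
def latVecs (W : Submodule ℂ (γ ⊕ γ' → ℂ)) : Set (γ ⊕ γ' → ℂ) :=
  {m | m ∈ W ∧ (∀ b, m (Sum.inl b) ∈ L.lattice) ∧ ∀ b, m (Sum.inr b) ∈ L'.lattice}

/-- **The projection maps the real span of the lattice vectors of `W` into `W`.** [folklore] -/
theorem ratProj₂_mem (χ : ℝ →ₗ[ℚ] ℚ) (W : Submodule ℂ (γ ⊕ γ' → ℂ)) {x : γ ⊕ γ' → ℂ}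
    (hx : x ∈ Submodule.span ℝ (latVecs L L' W)) : ratProj₂ L L' χ x ∈ W := by
  obtain ⟨n, f, g, rfl⟩ := Submodule.mem_span_set'.mp hx
  rw [map_sum]
  refine Submodule.sum_mem _ fun i _ => ?_
  obtain ⟨hgW, hgl, hgl'⟩ := (g i).2
  rw [ratProj₂_smul_ratVec L L' χ (f i) (isRatVec_of_lattice L L' hgl hgl')]
  exact W.smul_mem _ hgW

/-! ### Reconstruction from a Hamel basis of `ℝ` over `ℚ` -/

/-- **A vector of the real span of the lattice vectors of `W` is a finite real combination of its
rational projections** along the coordinate functionals of a Hamel basis of `ℝ` over `ℚ`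
(expand the real coefficients). [folklore] -/
theorem eq_sum_ratProj₂ (W : Submodule ℂ (γ ⊕ γ' → ℂ)) {x : γ ⊕ γ' → ℂ}
    (hx : x ∈ Submodule.span ℝ (latVecs L L' W)) :
    ∃ S : Finset (Module.Basis.ofVectorSpaceIndex ℚ ℝ),
      x = ∑ α ∈ S, ((Module.Basis.ofVectorSpace ℚ ℝ α : ℝ) : ℂ) •
        ratProj₂ L L' ((Module.Basis.ofVectorSpace ℚ ℝ).coord α) x := by
  classical
  set bR := Module.Basis.ofVectorSpace ℚ ℝ with hbR
  obtain ⟨n, f, g, rfl⟩ := Submodule.mem_span_set'.mp hx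
  -- a finite set of basis indices containing the supports of all the coefficients
  set S : Finset (Module.Basis.ofVectorSpaceIndex ℚ ℝ) := Finset.univ.biUnion fun i => (bR.repr (f i)).support
    with hS
  refine ⟨S, ?_⟩
  have hexp : ∀ i, f i = ∑ α ∈ S, bR.coord α (f i) • (bR α : ℝ) := by
    intro i
    have hsub : (bR.repr (f i)).support ⊆ S := Finset.subset_biUnion_of_mem (fun i => (bR.repr (f i)).support)
      (Finset.mem_univ i)
    have h := bR.linearCombination_repr (f i)
    rw [Finsupp.linearCombination_apply, Finsupp.sum_of_support_subset _ hsub (fun α a => a • bR α)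
      (fun α _ => zero_smul ℚ _)] at h
    exact h.symm
  -- the projections of `∑ f_i g_i`
  have hproj : ∀ α, ratProj₂ L L' (bR.coord α) (∑ i, f i • (g i : γ ⊕ γ' → ℂ)) =
      ∑ i, ((bR.coord α (f i) : ℚ) : ℂ) • (g i : γ ⊕ γ' → ℂ) := by
    intro α
    rw [map_sum]
    refine Finset.sum_congr rfl fun i _ => ?_
    obtain ⟨-, hgl, hgl'⟩ := (g i).2
    exact ratProj₂_smul_ratVec L L' _ (f i) (isRatVec_of_lattice L L' hgl hgl')
  simp only [hproj]
  calc ∑ i, f i • (g i : γ ⊕ γ' → ℂ)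
      = ∑ i, ∑ α ∈ S, (((bR.coord α (f i) : ℚ) : ℝ) * (bR α : ℝ)) • (g i : γ ⊕ γ' → ℂ) := by
        refine Finset.sum_congr rfl fun i _ => ?_
        conv_lhs => rw [hexp i]
        rw [Finset.sum_smul]
        refine Finset.sum_congr rfl fun α _ => ?_
        rw [Rat.smul_def]
    _ = ∑ α ∈ S, ((bR α : ℝ) : ℂ) • ∑ i, ((bR.coord α (f i) : ℚ) : ℂ) • (g i : γ ⊕ γ' → ℂ) := by
        rw [Finset.sum_comm]
        refine Finset.sum_congr rfl fun α _ => ?_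
        rw [Finset.smul_sum]
        refine Finset.sum_congr rfl fun i _ => ?_
        ext b
        simp only [Pi.smul_apply, Complex.real_smul, smul_eq_mul]
        push_cast
        ring

/-! ### Rational vectors are real multiples of lattice vectors -/

/-- A vector with rational coordinates is `d⁻¹` times a vector with lattice coordinates, for a
common denominator `d ≥ 1`. [folklore] -/
theorem exists_nat_smul_lattice_of_isRatVec [Fintype γ] [Fintype γ'] {m : γ ⊕ γ' → ℂ}
    (hm : IsRatVec L L' m) :
    ∃ d : ℕ, 0 < d ∧ (∀ b, ((d : ℂ) • m) (Sum.inl b) ∈ L.lattice) ∧ ∀ b, ((d : ℂ) • m) (Sum.inr b) ∈ L'.lattice := by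
  classical
  choose p q hpq using hm.1
  choose p' q' hpq' using hm.2
  -- product of all denominators
  set d : ℕ := (∏ b, (p b).den * (q b).den) * ∏ b, (p' b).den * (q' b).den with hd
  have hdpos : 0 < d := by
    rw [hd]
    refine Nat.mul_pos (Finset.prod_pos fun b _ => Nat.mul_pos (p b).den_pos (q b).den_pos)
      (Finset.prod_pos fun b _ => Nat.mul_pos (p' b).den_pos (q' b).den_pos)
  -- `d r` is an integer when `r.den ∣ d`
  have hint : ∀ r : ℚ, r.den ∣ d → ∃ z : ℤ, (d : ℂ) * (r : ℂ) = z := by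
    intro r hr
    obtain ⟨k, hk⟩ := hr
    refine ⟨k * r.num, ?_⟩
    have h := Rat.mul_den_eq_num r
    have h' : ((d : ℚ) * r) = (k * r.num : ℤ) := by
      rw [hk]; push_cast; linear_combination (k : ℚ) * h
    exact_mod_cast congrArg (fun t : ℚ => (t : ℂ)) h'
  have hdvd1 : ∀ b, (p b).den ∣ d ∧ (q b).den ∣ d := by
    intro b
    have h1 : (p b).den * (q b).den ∣ ∏ b, (p b).den * (q b).den := Finset.dvd_prod_of_mem _ (Finset.mem_univ b)
    have h2 : (∏ b, (p b).den * (q b).den) ∣ d := ⟨_, hd⟩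
    exact ⟨(dvd_mul_right _ _).trans (h1.trans h2), (dvd_mul_left _ _).trans (h1.trans h2)⟩
  have hdvd2 : ∀ b, (p' b).den ∣ d ∧ (q' b).den ∣ d := by
    intro b
    have h1 : (p' b).den * (q' b).den ∣ ∏ b, (p' b).den * (q' b).den := Finset.dvd_prod_of_mem _ (Finset.mem_univ b)
    have h2 : (∏ b, (p' b).den * (q' b).den) ∣ d := ⟨_, by rw [hd, mul_comm]⟩
    exact ⟨(dvd_mul_right _ _).trans (h1.trans h2), (dvd_mul_left _ _).trans (h1.trans h2)⟩
  refine ⟨d, hdpos, fun b => ?_, fun b => ?_⟩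
  · obtain ⟨z₁, hz₁⟩ := hint _ (hdvd1 b).1
    obtain ⟨z₂, hz₂⟩ := hint _ (hdvd1 b).2
    rw [Pi.smul_apply, smul_eq_mul, hpq b, show (d : ℂ) * ((p b : ℂ) * L.ω₁ + (q b : ℂ) * L.ω₂) =
      ((d : ℂ) * (p b : ℂ)) * L.ω₁ + ((d : ℂ) * (q b : ℂ)) * L.ω₂ by ring, hz₁, hz₂]
    exact PeriodPair.mem_lattice.mpr ⟨_, _, rfl⟩
  · obtain ⟨z₁, hz₁⟩ := hint _ (hdvd2 b).1
    obtain ⟨z₂, hz₂⟩ := hint _ (hdvd2 b).2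
    rw [Pi.smul_apply, smul_eq_mul, hpq' b, show (d : ℂ) * ((p' b : ℂ) * L'.ω₁ + (q' b : ℂ) * L'.ω₂) =
      ((d : ℂ) * (p' b : ℂ)) * L'.ω₁ + ((d : ℂ) * (q' b : ℂ)) * L'.ω₂ by ring, hz₁, hz₂]
    exact PeriodPair.mem_lattice.mpr ⟨_, _, rfl⟩

/-- **Rational vectors of `W` lie in the real span of its lattice vectors.** [folklore] -/
theorem mem_span_latVecs_of_isRatVec [Fintype γ] [Fintype γ'] (W : Submodule ℂ (γ ⊕ γ' → ℂ))
    {m : γ ⊕ γ' → ℂ} (hmW : m ∈ W) (hm : IsRatVec L L' m) :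
    m ∈ Submodule.span ℝ (latVecs L L' W) := by
  obtain ⟨d, hd, hl, hl'⟩ := exists_nat_smul_lattice_of_isRatVec L L' hm
  have hmem : (d : ℂ) • m ∈ latVecs L L' W := ⟨W.smul_mem _ hmW, hl, hl'⟩
  have hd0 : (d : ℝ) ≠ 0 := by exact_mod_cast hd.ne'
  have e : m = (d : ℝ)⁻¹ • ((d : ℂ) • m) := by
    rw [show ((d : ℂ) • m) = ((d : ℝ) • m) by ext b; simp [Complex.real_smul], smul_smul,
      inv_mul_cancel₀ hd0, one_smul]
  rw [e]
  exact Submodule.smul_mem _ _ (Submodule.subset_span hmem)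

/-! ### The slices `W ∩ ℂ^γ`, `W ∩ ℂ^{γ'}` and the projections -/

/-- Embedding of the `γ`-block. [folklore] -/
def inlV : (γ → ℂ) →ₗ[ℂ] (γ ⊕ γ' → ℂ) where
  toFun z := Sum.elim z 0
  map_add' z w := by ext b; rcases b with b | b <;> simp
  map_smul' c z := by ext b; rcases b with b | b <;> simp

/-- Embedding of the `γ'`-block. [folklore] -/
def inrV : (γ' → ℂ) →ₗ[ℂ] (γ ⊕ γ' → ℂ) where
  toFun z := Sum.elim 0 z
  map_add' z w := by ext b; rcases b with b | b <;> simp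
  map_smul' c z := by ext b; rcases b with b | b <;> simp

/-- Projection to the `γ`-block. [folklore] -/
def fstV : (γ ⊕ γ' → ℂ) →ₗ[ℂ] (γ → ℂ) where
  toFun z := z ∘ Sum.inl
  map_add' _ _ := rfl
  map_smul' _ _ := rfl

/-- Projection to the `γ'`-block. [folklore] -/
def sndV : (γ ⊕ γ' → ℂ) →ₗ[ℂ] (γ' → ℂ) where
  toFun z := z ∘ Sum.inr
  map_add' _ _ := rfl
  map_smul' _ _ := rfl

/-- Entries of the `γ`-embedding on `γ`. [folklore] -/
@[simp] theorem inlV_apply_inl (z : γ → ℂ) (b : γ) : (inlV z : γ ⊕ γ' → ℂ) (Sum.inl b) = z b := rfl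
/-- Entries of the `γ`-embedding on `γ'`. [folklore] -/
@[simp] theorem inlV_apply_inr (z : γ → ℂ) (b : γ') : (inlV z : γ ⊕ γ' → ℂ) (Sum.inr b) = 0 := rfl
/-- Entries of the `γ'`-embedding on `γ`. [folklore] -/
@[simp] theorem inrV_apply_inl (z : γ' → ℂ) (b : γ) : (inrV z : γ ⊕ γ' → ℂ) (Sum.inl b) = 0 := rfl
/-- Entries of the `γ'`-embedding on `γ'`. [folklore] -/
@[simp] theorem inrV_apply_inr (z : γ' → ℂ) (b : γ') : (inrV z : γ ⊕ γ' → ℂ) (Sum.inr b) = z b := rfl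
/-- Entries of the `γ`-projection. [folklore] -/
@[simp] theorem fstV_apply (z : γ ⊕ γ' → ℂ) (b : γ) : fstV (γ' := γ') z b = z (Sum.inl b) := rfl
/-- Entries of the `γ'`-projection. [folklore] -/
@[simp] theorem sndV_apply (z : γ ⊕ γ' → ℂ) (b : γ') : sndV (γ := γ) z b = z (Sum.inr b) := rfl

/-- `z = (z_γ, 0) + (0, z_{γ'})`. [folklore] -/
theorem inlV_add_inrV (z : γ ⊕ γ' → ℂ) : inlV (fstV z) + inrV (sndV z) = z := by
  ext b; rcases b with b | b <;> simp

variable [Fintype γ] [Fintype γ']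

omit [Fintype γ] in
/-- **The `γ'`-slice satisfies the one-lattice hypothesis for `Λ'`**: every
`z' ∈ W.comap inrV` is a real combination of lattice vectors of the slice. [folklore] -/
theorem comap_inrV_subset_span (W : Submodule ℂ (γ ⊕ γ' → ℂ))
    (hW : (W : Set (γ ⊕ γ' → ℂ)) ⊆ Submodule.span ℝ (latVecs L L' W)) :
    ((W.comap inrV : Submodule ℂ (γ' → ℂ)) : Set (γ' → ℂ)) ⊆
      Submodule.span ℝ {n : γ' → ℂ | n ∈ W.comap inrV ∧ ∀ b, n b ∈ L'.lattice} := by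
  classical
  intro z' hz'
  set w : γ ⊕ γ' → ℂ := inrV z' with hwdef
  have hw : w ∈ W := hz'
  obtain ⟨S, hS⟩ := eq_sum_ratProj₂ L L' W (hW hw)
  set bR := Module.Basis.ofVectorSpace ℚ ℝ
  -- each projection is a rational vector of `W` with zero `γ`-part
  have hv : ∀ α, ratProj₂ L L' (bR.coord α) w ∈ W ∧
      (∀ b : γ, ratProj₂ L L' (bR.coord α) w (Sum.inl b) = 0) := fun α =>
    ⟨ratProj₂_mem L L' _ W (hW hw), fun b => by simp [ratProj₂_inl, reCoord_apply, hwdef]⟩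
  -- hence its `γ'`-part is a rational vector of the slice, a real multiple of a lattice vector
  have hmem : ∀ α, (sndV (ratProj₂ L L' (bR.coord α) w) : γ' → ℂ) ∈
      Submodule.span ℝ {n : γ' → ℂ | n ∈ W.comap inrV ∧ ∀ b, n b ∈ L'.lattice} := by
    intro α
    set v := ratProj₂ L L' (bR.coord α) w with hvdef
    have hvinr : (inrV (sndV v) : γ ⊕ γ' → ℂ) = v := by
      ext b; rcases b with b | b
      · simpa using ((hv α).2 b).symm
      · simp
    have hvW : sndV (γ := γ) v ∈ W.comap inrV := by
      show (inrV (sndV v) : γ ⊕ γ' → ℂ) ∈ W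
      rw [hvinr]; exact (hv α).1
    -- rational coordinates
    have hrat : ∀ b, ∃ p q : ℚ, sndV v b = (p : ℂ) * L'.ω₁ + (q : ℂ) * L'.ω₂ := fun b =>
      ⟨_, _, ratProj₂_inr L L' _ _ b⟩
    choose p q hpq using hrat
    set d : ℕ := ∏ b, (p b).den * (q b).den with hd
    have hdpos : 0 < d := Finset.prod_pos fun b _ => Nat.mul_pos (p b).den_pos (q b).den_pos
    have hint : ∀ r : ℚ, r.den ∣ d → ∃ z : ℤ, (d : ℂ) * (r : ℂ) = z := by
      intro r hr
      obtain ⟨k, hk⟩ := hr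
      refine ⟨k * r.num, ?_⟩
      have h := Rat.mul_den_eq_num r
      have h' : ((d : ℚ) * r) = (k * r.num : ℤ) := by
        rw [hk]; push_cast; linear_combination (k : ℚ) * h
      exact_mod_cast congrArg (fun t : ℚ => (t : ℂ)) h'
    have hlat : ∀ b, ((d : ℂ) • sndV v) b ∈ L'.lattice := by
      intro b
      have h1 : (p b).den * (q b).den ∣ d := Finset.dvd_prod_of_mem _ (Finset.mem_univ b)
      obtain ⟨z₁, hz₁⟩ := hint _ ((dvd_mul_right _ _).trans h1)
      obtain ⟨z₂, hz₂⟩ := hint _ ((dvd_mul_left _ _).trans h1)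
      rw [Pi.smul_apply, smul_eq_mul, hpq b, show (d : ℂ) * ((p b : ℂ) * L'.ω₁ + (q b : ℂ) * L'.ω₂) =
        ((d : ℂ) * (p b : ℂ)) * L'.ω₁ + ((d : ℂ) * (q b : ℂ)) * L'.ω₂ by ring, hz₁, hz₂]
      exact PeriodPair.mem_lattice.mpr ⟨_, _, rfl⟩
    have hdmem : (d : ℂ) • sndV v ∈ {n : γ' → ℂ | n ∈ W.comap inrV ∧ ∀ b, n b ∈ L'.lattice} :=
      ⟨Submodule.smul_mem _ _ hvW, hlat⟩
    have hd0 : (d : ℝ) ≠ 0 := by exact_mod_cast hdpos.ne'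
    have e : sndV v = (d : ℝ)⁻¹ • ((d : ℂ) • sndV v) := by
      rw [show ((d : ℂ) • sndV v) = ((d : ℝ) • sndV v) by ext b; simp [Complex.real_smul], smul_smul,
        inv_mul_cancel₀ hd0, one_smul]
    rw [e]
    exact Submodule.smul_mem _ _ (Submodule.subset_span hdmem)
  -- `z'` is the corresponding real combination
  have hz'eq : z' = ∑ α ∈ S, ((bR α : ℝ) : ℂ) • sndV (γ := γ) (ratProj₂ L L' (bR.coord α) w) := by
    have h := congrArg (sndV (γ := γ)) hS
    rw [map_sum] at h
    simp only [map_smul] at h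
    have : sndV (γ := γ) w = z' := by ext b; simp [hwdef]
    rw [this] at h
    exact h
  rw [hz'eq]
  refine Submodule.sum_mem _ fun α _ => ?_
  rw [show (((bR α : ℝ) : ℂ) • sndV (γ := γ) (ratProj₂ L L' (bR.coord α) w)) =
    ((bR α : ℝ) • sndV (γ := γ) (ratProj₂ L L' (bR.coord α) w)) by ext b; simp [Complex.real_smul]]
  exact Submodule.smul_mem _ _ (hmem α)

omit [Fintype γ] [Fintype γ'] in
/-- **The `γ`-projection satisfies the one-lattice hypothesis for `Λ`.** [folklore] -/
theorem map_fstV_subset_span (W : Submodule ℂ (γ ⊕ γ' → ℂ))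
    (hW : (W : Set (γ ⊕ γ' → ℂ)) ⊆ Submodule.span ℝ (latVecs L L' W)) :
    ((W.map fstV : Submodule ℂ (γ → ℂ)) : Set (γ → ℂ)) ⊆
      Submodule.span ℝ {n : γ → ℂ | n ∈ W.map fstV ∧ ∀ b, n b ∈ L.lattice} := by
  rintro _ ⟨w, hw, rfl⟩
  obtain ⟨n, f, g, hsum⟩ := Submodule.mem_span_set'.mp (hW hw)
  have : fstV (γ' := γ') w = ∑ i, f i • fstV (γ' := γ') (g i : γ ⊕ γ' → ℂ) := by
    rw [← hsum, map_sum]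
    refine Finset.sum_congr rfl fun i _ => ?_
    ext b; simp [Complex.real_smul]
  rw [this]
  refine Submodule.sum_mem _ fun i _ => Submodule.smul_mem _ _ (Submodule.subset_span ?_)
  obtain ⟨hgW, hgl, -⟩ := (g i).2
  exact ⟨⟨_, hgW, rfl⟩, fun b => hgl b⟩

/-! ### The product structure -/

omit [Fintype γ] [Fintype γ'] in
/-- **A lift with rational coordinates.** If `u ∈ fstV(W)` has rational coordinates
`u_b = a_b ω₁ + e_b ω₂`, some `w ∈ W` with `γ`-part `u` has rational coordinates (apply a
rational retraction to any lift). [folklore] -/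
theorem exists_ratLift (W : Submodule ℂ (γ ⊕ γ' → ℂ))
    (hW : (W : Set (γ ⊕ γ' → ℂ)) ⊆ Submodule.span ℝ (latVecs L L' W)) {u : γ → ℂ}
    (hu : u ∈ W.map fstV) (a e : γ → ℚ) (hue : ∀ b, u b = (a b : ℂ) * L.ω₁ + (e b : ℂ) * L.ω₂) :
    ∃ w ∈ W, fstV w = u ∧ IsRatVec L L' w := by
  obtain ⟨w', hw', hfw'⟩ := hu
  obtain ⟨χ, hχ⟩ := exists_ratRetraction
  refine ⟨ratProj₂ L L' χ w', ratProj₂_mem L L' χ W (hW hw'), ?_, isRatVec_ratProj₂ L L' χ w'⟩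
  ext b
  rw [fstV_apply, ratProj₂_inl]
  have hwb : w' (Sum.inl b) = u b := by rw [← hfw']; rfl
  have ecast : (a b : ℂ) * L.ω₁ + (e b : ℂ) * L.ω₂ = ((a b : ℝ) : ℂ) * L.ω₁ + ((e b : ℝ) : ℂ) * L.ω₂ := by
    push_cast; ring
  rw [hwb, hue b, ecast, (reCoord_combo L _ _).1, (reCoord_combo L _ _).2]
  have ha : χ (a b : ℝ) = a b := by rw [← Rat.smul_one_eq_cast, map_smul, hχ, smul_eq_mul, mul_one]
  have he : χ (e b : ℝ) = e b := by rw [← Rat.smul_one_eq_cast, map_smul, hχ, smul_eq_mul, mul_one]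
  rw [ha, he]
  push_cast; ring

omit [Fintype γ] in
/-- The functional `Φ_{c'}(w) = ∑_b c'_b w_{b}` (`b ∈ γ'`) of a rational relation `c'` of the
`γ'`-slice: it kills the `γ'`-slice, hence only depends on the `γ`-part of `w ∈ W`. [folklore] -/
theorem sum_sndV_eq_of_fstV_eq (W : Submodule ℂ (γ ⊕ γ' → ℂ)) {c' : γ' → ℚ}
    (hc' : ∀ n ∈ W.comap inrV, ∑ b, (c' b : ℂ) * (n : γ' → ℂ) b = 0) {w₁ w₂ : γ ⊕ γ' → ℂ}
    (hw₁ : w₁ ∈ W) (hw₂ : w₂ ∈ W) (h : fstV w₁ = fstV w₂) :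
    ∑ b, (c' b : ℂ) * w₁ (Sum.inr b) = ∑ b, (c' b : ℂ) * w₂ (Sum.inr b) := by
  have hmem : sndV (w₁ - w₂) ∈ W.comap inrV := by
    show (inrV (sndV (w₁ - w₂)) : γ ⊕ γ' → ℂ) ∈ W
    have : (inrV (sndV (w₁ - w₂)) : γ ⊕ γ' → ℂ) = w₁ - w₂ := by
      ext b; rcases b with b | b
      · have := congr_fun h b
        simp only [fstV_apply] at this
        simp [this]
      · simp
    rw [this]; exact W.sub_mem hw₁ hw₂
  have h0 := hc' _ hmem
  simp only [sndV_apply, Pi.sub_apply, mul_sub, Finset.sum_sub_distrib] at h0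
  exact sub_eq_zero.mp h0

omit [Fintype γ] in
/-- The value of `Φ_{c'}` at a vector with rational coordinates lies in `ℚ ω₁' + ℚ ω₂'`. [folklore] -/
theorem exists_rat_sum_of_isRatVec (c' : γ' → ℚ) {w : γ ⊕ γ' → ℂ} (hw : IsRatVec L L' w) :
    ∃ A B : ℚ, ∑ b, (c' b : ℂ) * w (Sum.inr b) = (A : ℂ) * L'.ω₁ + (B : ℂ) * L'.ω₂ := by
  choose p q hpq using hw.2
  refine ⟨∑ b, c' b * p b, ∑ b, c' b * q b, ?_⟩
  push_cast
  rw [Finset.sum_mul, Finset.sum_mul, ← Finset.sum_add_distrib]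
  refine Finset.sum_congr rfl fun b _ => ?_
  rw [hpq b]; ring

/-- **Product structure, on lattice vectors.** Under `¬CM(Λ')`, `Λ ≁ Λ'`, and the real-span
hypothesis, for every lattice vector `m ∈ W` the `γ`-part `(m_γ, 0)` lies in `W`. [folklore] -/
theorem inlV_mem_of_lattice (hCM : ¬ L.HasCM) (hCM' : ¬ L'.HasCM) (hiso : ¬ L.IsIsogenousTo L')
    (W : Submodule ℂ (γ ⊕ γ' → ℂ))
    (hW : (W : Set (γ ⊕ γ' → ℂ)) ⊆ Submodule.span ℝ (latVecs L L' W))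
    {m : γ ⊕ γ' → ℂ} (hm : m ∈ latVecs L L' W) : (inlV (fstV m) : γ ⊕ γ' → ℂ) ∈ W := by
  classical
  obtain ⟨hmW, hml, hml'⟩ := hm
  by_contra hnot
  -- the `γ'`-slice and its rational relations
  set W' : Submodule ℂ (γ' → ℂ) := W.comap inrV with hW'
  have hW'span := comap_inrV_subset_span L L' W hW
  -- `m_{γ'} ∉ W'`
  have hm' : sndV m ∉ W' := by
    intro h
    apply hnot
    have : (inlV (fstV m) : γ ⊕ γ' → ℂ) = m - inrV (sndV m) := by
      rw [eq_sub_iff_add_eq, inlV_add_inrV]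
    rw [this]
    exact W.sub_mem hmW h
  -- a rational relation of `W'` not killing `m_{γ'}`
  have hrel : ∃ c' ∈ ratRels W', ∑ b, (c' b : ℂ) * m (Sum.inr b) ≠ 0 := by
    by_contra hall
    push Not at hall
    exact hm' ((mem_iff_forall_ratRels L' hCM' W' hW'span (sndV m)).mpr fun c hc => by
      simpa using hall c hc)
  obtain ⟨c', hc'C, hx⟩ := hrel
  have hc'kill : ∀ n ∈ W', ∑ b, (c' b : ℂ) * (n : γ' → ℂ) b = 0 := fun n hn =>
    (mem_iff_forall_ratRels L' hCM' W' hW'span n).mp hn c' hc'C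
  -- the `γ`-projection is rational for `Λ`: `p ω₁, p ω₂, q ω₁, q ω₂ ∈ fstV(W)`
  set U : Submodule ℂ (γ → ℂ) := W.map fstV with hU
  have hUspan := map_fstV_subset_span L L' W hW
  choose p q hpq using fun b => PeriodPair.mem_lattice.mp (hml b)
  have hmU : fstV m ∈ U := ⟨m, hmW, rfl⟩
  have hrelU : ∀ c ∈ ratRels U, ∑ b, (c b : ℂ) * (p b : ℂ) = 0 ∧ ∑ b, (c b : ℂ) * (q b : ℂ) = 0 := by
    intro c hc
    have h := (mem_iff_forall_ratRels L hCM U hUspan (fstV m)).mp hmU c hc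
    simp only [fstV_apply] at h
    have h' : (∑ b, (c b : ℂ) * (p b : ℂ)) * L.ω₁ + (∑ b, (c b : ℂ) * (q b : ℂ)) * L.ω₂ = 0 := by
      rw [← h, Finset.sum_mul, Finset.sum_mul, ← Finset.sum_add_distrib]
      exact Finset.sum_congr rfl fun b _ => by rw [← hpq b]; ring
    -- real and rational: compare coefficients
    have hre : ∀ r : γ → ℤ, ((∑ b, (c b : ℂ) * (r b : ℂ)) : ℂ) = ((∑ b, c b * r b : ℚ) : ℝ) := fun r => by
      push_cast; rfl
    rw [hre p, hre q] at h'
    have hind := LinearIndependent.pair_iff.mp L.indep ((∑ b, c b * p b : ℚ) : ℝ) ((∑ b, c b * q b : ℚ) : ℝ)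
      (by simpa [Complex.real_smul] using h')
    refine ⟨?_, ?_⟩
    · have := hind.1; rw [hre p]; exact_mod_cast this
    · have := hind.2; rw [hre q]; exact_mod_cast this
  have hvecU : ∀ (r : γ → ℤ), (∀ c ∈ ratRels U, ∑ b, (c b : ℂ) * (r b : ℂ) = 0) →
      ∀ ω : ℂ, (fun b => (r b : ℂ) * ω) ∈ U := by
    intro r hr ω
    refine (mem_iff_forall_ratRels L hCM U hUspan _).mpr fun c hc => ?_
    rw [show ∑ b, (c b : ℂ) * ((r b : ℂ) * ω) = (∑ b, (c b : ℂ) * (r b : ℂ)) * ω by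
      rw [Finset.sum_mul]; exact Finset.sum_congr rfl fun b _ => by ring, hr c hc, zero_mul]
  have hpU : ∀ ω : ℂ, (fun b => (p b : ℂ) * ω) ∈ U := hvecU p fun c hc => (hrelU c hc).1
  have hqU : ∀ ω : ℂ, (fun b => (q b : ℂ) * ω) ∈ U := hvecU q fun c hc => (hrelU c hc).2
  -- rational lifts of `p ω₁, p ω₂, q ω₁, q ω₂`
  have hlift : ∀ (r : γ → ℤ), (∀ ω : ℂ, (fun b => (r b : ℂ) * ω) ∈ U) →
      ∀ i : Fin 2, ∃ w ∈ W, fstV w = (fun b => (r b : ℂ) * ![L.ω₁, L.ω₂] i) ∧ IsRatVec L L' w := by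
    intro r hr i
    fin_cases i
    · exact exists_ratLift L L' W hW (hr L.ω₁) (fun b => r b) (fun _ => 0) fun b => by push_cast; simp
    · exact exists_ratLift L L' W hW (hr L.ω₂) (fun _ => 0) (fun b => r b) fun b => by push_cast; simp
  obtain ⟨w₁, hw₁W, hw₁f, hw₁r⟩ := hlift p hpU 0
  obtain ⟨w₂, hw₂W, hw₂f, hw₂r⟩ := hlift p hpU 1
  obtain ⟨w₃, hw₃W, hw₃f, hw₃r⟩ := hlift q hqU 0
  obtain ⟨w₄, hw₄W, hw₄f, hw₄r⟩ := hlift q hqU 1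
  simp only [Fin.isValue, Matrix.cons_val_zero, Matrix.cons_val_one] at hw₁f hw₂f hw₃f hw₄f
  -- the values `x_i = Φ(w_i) ∈ ℚ ω₁' + ℚ ω₂'`
  set Φ : (γ ⊕ γ' → ℂ) → ℂ := fun w => ∑ b, (c' b : ℂ) * w (Sum.inr b) with hΦ
  have hΦlin : ∀ (w w' : γ ⊕ γ' → ℂ) (s : ℂ), Φ (s • w - w') = s * Φ w - Φ w' := by
    intro w w' s
    simp only [hΦ, Pi.sub_apply, Pi.smul_apply, smul_eq_mul, mul_sub, Finset.sum_sub_distrib, Finset.mul_sum]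
    congr 1
    exact Finset.sum_congr rfl fun b _ => by ring
  -- `τ x₁ = x₂`, `τ x₃ = x₄`
  have hτ12 : tau L * Φ w₁ = Φ w₂ := by
    have hmem : tau L • w₁ - w₂ ∈ W := W.sub_mem (W.smul_mem _ hw₁W) hw₂W
    have hfst : fstV (tau L • w₁ - w₂) = fstV (0 : γ ⊕ γ' → ℂ) := by
      ext b
      simp only [map_sub, map_smul, Pi.sub_apply, Pi.smul_apply, smul_eq_mul, hw₁f, hw₂f, map_zero, Pi.zero_apply]
      have := tau_mul_ω₁ L
      linear_combination (p b : ℂ) * this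
    have h := sum_sndV_eq_of_fstV_eq W hc'kill hmem W.zero_mem hfst
    have h2 : Φ (tau L • w₁ - w₂) = 0 := by simpa [hΦ] using h
    rw [hΦlin] at h2
    exact sub_eq_zero.mp h2
  have hτ34 : tau L * Φ w₃ = Φ w₄ := by
    have hmem : tau L • w₃ - w₄ ∈ W := W.sub_mem (W.smul_mem _ hw₃W) hw₄W
    have hfst : fstV (tau L • w₃ - w₄) = fstV (0 : γ ⊕ γ' → ℂ) := by
      ext b
      simp only [map_sub, map_smul, Pi.sub_apply, Pi.smul_apply, smul_eq_mul, hw₃f, hw₄f, map_zero, Pi.zero_apply]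
      have := tau_mul_ω₁ L
      linear_combination (q b : ℂ) * this
    have h := sum_sndV_eq_of_fstV_eq W hc'kill hmem W.zero_mem hfst
    have h2 : Φ (tau L • w₃ - w₄) = 0 := by simpa [hΦ] using h
    rw [hΦlin] at h2
    exact sub_eq_zero.mp h2
  -- `Φ(m) = x₁ + x₄`
  have hsum : Φ m = Φ w₁ + Φ w₄ := by
    have hmem : (1 : ℂ) • m - (w₁ + w₄) ∈ W := W.sub_mem (W.smul_mem _ hmW) (W.add_mem hw₁W hw₄W)
    have hfst : fstV ((1 : ℂ) • m - (w₁ + w₄)) = fstV (0 : γ ⊕ γ' → ℂ) := by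
      ext b
      simp only [one_smul, Pi.sub_apply, Pi.add_apply, fstV_apply, Pi.zero_apply]
      rw [show w₁ (Sum.inl b) = (p b : ℂ) * L.ω₁ from congr_fun hw₁f b,
        show w₄ (Sum.inl b) = (q b : ℂ) * L.ω₂ from congr_fun hw₄f b, ← hpq b]
      ring
    have h := sum_sndV_eq_of_fstV_eq W hc'kill hmem W.zero_mem hfst
    have h2 : Φ ((1 : ℂ) • m - (w₁ + w₄)) = 0 := by simpa [hΦ] using h
    rw [hΦlin, one_mul] at h2
    have h3 : Φ (w₁ + w₄) = Φ w₁ + Φ w₄ := by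
      simp only [hΦ, Pi.add_apply, mul_add, Finset.sum_add_distrib]
    rw [h3] at h2
    linear_combination h2
  -- rationality of the values
  obtain ⟨A₁, B₁, h₁⟩ := exists_rat_sum_of_isRatVec L L' c' hw₁r
  obtain ⟨A₂, B₂, h₂⟩ := exists_rat_sum_of_isRatVec L L' c' hw₂r
  obtain ⟨A₃, B₃, h₃⟩ := exists_rat_sum_of_isRatVec L L' c' hw₃r
  obtain ⟨A₄, B₄, h₄⟩ := exists_rat_sum_of_isRatVec L L' c' hw₄r
  change Φ w₁ = _ at h₁
  change Φ w₂ = _ at h₂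
  change Φ w₃ = _ at h₃
  change Φ w₄ = _ at h₄
  -- case split: `x₁ ≠ 0` or `x₃ ≠ 0`
  by_cases hx1 : Φ w₁ = 0
  · have hx4 : Φ w₄ ≠ 0 := by
      intro h4
      apply hx
      change Φ m = 0
      rw [hsum, hx1, h4, add_zero]
    have hx3 : Φ w₃ ≠ 0 := by
      intro h3'
      apply hx4
      rw [← hτ34, h3', mul_zero]
    refine hiso (isIsogenousTo_of_tau_mul_mem L L' A₃ B₃ A₄ B₄ ?_ ?_)
    · rwa [← h₃]
    · rw [← h₃, ← h₄]; exact hτ34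
  · refine hiso (isIsogenousTo_of_tau_mul_mem L L' A₁ B₁ A₂ B₂ ?_ ?_)
    · rwa [← h₁]
    · rw [← h₁, ← h₂]; exact hτ12

/-- **Product structure.** Under the hypotheses, `W` contains with every vector its `γ`-part.
[folklore] -/
theorem inlV_fstV_mem (hCM : ¬ L.HasCM) (hCM' : ¬ L'.HasCM) (hiso : ¬ L.IsIsogenousTo L')
    (W : Submodule ℂ (γ ⊕ γ' → ℂ))
    (hW : (W : Set (γ ⊕ γ' → ℂ)) ⊆ Submodule.span ℝ (latVecs L L' W))
    {w : γ ⊕ γ' → ℂ} (hw : w ∈ W) : (inlV (fstV w) : γ ⊕ γ' → ℂ) ∈ W := by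
  obtain ⟨n, f, g, hsum⟩ := Submodule.mem_span_set'.mp (hW hw)
  have : (inlV (fstV w) : γ ⊕ γ' → ℂ) = ∑ i, ((f i : ℝ) : ℂ) • inlV (fstV (g i : γ ⊕ γ' → ℂ)) := by
    rw [← hsum]
    ext b
    rcases b with b | b <;> simp [Finset.sum_apply, Complex.real_smul]
  rw [this]
  exact W.sum_mem fun i _ => W.smul_mem _ (inlV_mem_of_lattice L L' hCM hCM' hiso W hW (g i).2)

/-- And its `γ'`-part. [folklore] -/
theorem inrV_sndV_mem (hCM : ¬ L.HasCM) (hCM' : ¬ L'.HasCM) (hiso : ¬ L.IsIsogenousTo L')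
    (W : Submodule ℂ (γ ⊕ γ' → ℂ))
    (hW : (W : Set (γ ⊕ γ' → ℂ)) ⊆ Submodule.span ℝ (latVecs L L' W))
    {w : γ ⊕ γ' → ℂ} (hw : w ∈ W) : (inrV (sndV w) : γ ⊕ γ' → ℂ) ∈ W := by
  have h : (inrV (sndV w) : γ ⊕ γ' → ℂ) = w - inlV (fstV w) := by
    rw [eq_sub_iff_add_eq, add_comm, inlV_add_inrV]
  rw [h]
  exact W.sub_mem hw (inlV_fstV_mem L L' hCM hCM' hiso W hW hw)

/-- **The `γ`-slice satisfies the one-lattice hypothesis for `Λ`** (by the product structure and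
the hypothesis). [folklore] -/
theorem comap_inlV_subset_span (hCM : ¬ L.HasCM) (hCM' : ¬ L'.HasCM) (hiso : ¬ L.IsIsogenousTo L')
    (W : Submodule ℂ (γ ⊕ γ' → ℂ))
    (hW : (W : Set (γ ⊕ γ' → ℂ)) ⊆ Submodule.span ℝ (latVecs L L' W)) :
    ((W.comap inlV : Submodule ℂ (γ → ℂ)) : Set (γ → ℂ)) ⊆
      Submodule.span ℝ {n : γ → ℂ | n ∈ W.comap inlV ∧ ∀ b, n b ∈ L.lattice} := by
  intro z hz
  have hw : (inlV z : γ ⊕ γ' → ℂ) ∈ W := hz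
  obtain ⟨n, f, g, hsum⟩ := Submodule.mem_span_set'.mp (hW hw)
  have : z = ∑ i, f i • fstV (γ' := γ') (g i : γ ⊕ γ' → ℂ) := by
    have h := congrArg (fstV (γ' := γ')) hsum
    rw [map_sum] at h
    have hz : fstV (γ' := γ') (inlV z : γ ⊕ γ' → ℂ) = z := by ext b; simp
    rw [hz] at h
    rw [← h]
    refine Finset.sum_congr rfl fun i _ => ?_
    ext b; simp [Complex.real_smul]
  rw [this]
  refine Submodule.sum_mem _ fun i _ => Submodule.smul_mem _ _ (Submodule.subset_span ⟨?_, fun b => ?_⟩)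
  · show (inlV (fstV (γ' := γ') (g i : γ ⊕ γ' → ℂ)) : γ ⊕ γ' → ℂ) ∈ W
    exact inlV_mem_of_lattice L L' hCM hCM' hiso W hW (g i).2
  · exact (g i).2.2.1 b

/-! ### The theorem -/

/-- **Complex subspaces spanned by lattice vectors of two non-isogenous lattices without complex
multiplication are products of rational subspaces**: if `W ≤ ℂ^{γ ⊕ γ'}` is contained in the real
span of its lattice vectors (`Λ` on `γ`, `Λ'` on `γ'`), then
`W = {z ; ∑_b c_b z_b = 0 (c ∈ C), ∑_b c'_b z_b = 0 (c' ∈ C')}` for `ℚ`-subspaces `C ≤ ℚ^γ`,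
`C' ≤ ℚ^{γ'}` — the shape `(C, C')` of `GaGmEE.Std.SubgroupDataC`. [folklore] -/
theorem exists_ratRels (hCM : ¬ L.HasCM) (hCM' : ¬ L'.HasCM) (hiso : ¬ L.IsIsogenousTo L')
    (W : Submodule ℂ (γ ⊕ γ' → ℂ))
    (hW : (W : Set (γ ⊕ γ' → ℂ)) ⊆ Submodule.span ℝ (latVecs L L' W)) :
    ∃ (C : Submodule ℚ (γ → ℚ)) (C' : Submodule ℚ (γ' → ℚ)), ∀ z : γ ⊕ γ' → ℂ,
      z ∈ W ↔ (∀ c ∈ C, ∑ b, (c b : ℂ) * z (Sum.inl b) = 0) ∧ ∀ c' ∈ C', ∑ b, (c' b : ℂ) * z (Sum.inr b) = 0 := by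
  refine ⟨ratRels (W.comap inlV), ratRels (W.comap inrV), fun z => ?_⟩
  have h1 := mem_iff_forall_ratRels L hCM (W.comap inlV) (comap_inlV_subset_span L L' hCM hCM' hiso W hW) (fstV z)
  have h2 := mem_iff_forall_ratRels L' hCM' (W.comap inrV) (comap_inrV_subset_span L L' W hW) (sndV z)
  simp only [fstV_apply, sndV_apply] at h1 h2
  constructor
  · intro hz
    exact ⟨h1.mp (inlV_fstV_mem L L' hCM hCM' hiso W hW hz), h2.mp (inrV_sndV_mem L L' hCM hCM' hiso W hW hz)⟩
  · rintro ⟨hz1, hz2⟩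
    rw [← inlV_add_inrV z]
    exact W.add_mem (h1.mpr hz1) (h2.mpr hz2)

end NonIsogLattice

end Literature.NumberTheory.Transcendental

end
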